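/-
Copyright (c) 2026 the pub-hodgecm-mathlib formalisation cell (harness21).  Prover seat hodgecm-mathlib-F0P3-p02 (g27), 2026-09-03.  E1 row 63-C «K2′ REALISATION AT THE DATUM
PROPER» (E1 keeper ∕ dealer F0P3a-p03 (g30) 04:54:37Z «= 63-C, GO»; the K2′ twin of ★ 64-C `F0P3cStCharTSLdsRealisation` (F0P3b-p01 (g26)); generic half ★ row 63
`IrreducibleEmbeddingSchurPair` p853497, SENTENCE-letter rider ★ `F0P3cStCharTSPiTwoRealisation` p853542).
-/
import Summits.HodgeConjecture.HodgeConjecture.Theorems.F0P3KeysLabelledPair                  -- ★ (this lineage, g8) p833040: `labelledPair_of_reducible` (the labelled pair of `i_B(χ_ξ)`); brings ★ `isAdmissible_cmPrincipalSeries`, `Gqs`, `cmXiTorusChar`, `continuous_cmXiTorusChar_fst`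
import Summits.HodgeConjecture.HodgeConjecture.Theorems.F0P3U3PrincipalSeriesLettersHold        -- ★ N2 `u3PrincipalSeriesConstituentEmbeds_holds`, ★ N3 `u3PrincipalSeriesLengthLeTwo_holds`; brings ★ N1 `U3PrincipalSeriesJacquetFiltration_holds`
import Summits.HodgeConjecture.HodgeConjecture.Theorems.F0P3bCentralCharacterUnitaryNonsplit     -- ★ `exists_isOpen_isCompact_subgroup_cmLocal` (the compact open `K` of admissible Schur)
import Summits.HodgeConjecture.HodgeConjecture.Theorems.F0P2nBorelCharactersUnipotent           -- ★ `deltaChar_cmBorel_eq_one` (`δ_B|_N = 1`)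
import Literature.NumberTheory.Automorphic.IrreducibleEmbeddingSchurPair                         -- ★ row 63 (this seat) p853497: `IrrClass.exists_realisation_schurPair`
import HarnessLib

/-!
# F0 · P3c · line LH6 «StCharTS» — E1 row 63-C: THE K2′ REALISATION AT THE CM DATUM — `π²(ξ) ↪ i_B(χ_ξ)` with its Schur pair, its labels, and `r_B(i_B(χ_ξ)∕π²(ξ)) ≠ 0`

Cell `pub/hodgecm-mathlib` (D-0151), crux H413 = `stmt-HodgeConjecture-24833`; lane `--kind proof --supports stmt-HodgeConjecture-24833 --as helper` (THEOREMS ONLY: no definition ∕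
instance ∕ notation ∕ named fact ∕ `sorry`; count-neutral: closes no node).  Namespace `Summit.HodgeConjecture.HodgeConjecture.Cruxes.H413.F0P3cStCharTSPiTwoRealisationXi`.
HONEST LABEL: E1 = PRINT until the keeper's charter test; h413 OPEN; HC_CM is proved only modulo the printed citations (2 remaining named inputs hLiu418 =
stmt-HodgeConjecture-24832, h413 = stmt-HodgeConjecture-24833) until rung 0 closes; nothing printed is asserted here — N1∕N2∕N3 ([Casselman1995] L. 7.1.1 (a), Cor. 6.3.9 (b),
Cor. 7.1.2 for `U(3)`) are ★ (`…_holds`), the one datum input is the REDUCIBILITY `hred` of `i_B(χ_ξ)` (the hypothesis shape of ★ `labelledPair_of_reducible` ∕ KeysCaseTwo).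

THE MATHEMATICS ([Rogawski1990 §12.2 (2) pp. 173–174]; [Keys1984 §3, §7]; [Casselman1995 Thm 3.2.4, Cor. 6.3.9, Cor. 7.1.2]; [Bump1997 Prop. 4.2.4]).  At a place `v` of `L⁺` non-split in `L`
(`hns`), for `χ_ξ = cmXiTorusChar L v μ η₁ η₂` (`μ` restricting to the quadratic character, `hμ`; continuity `hμc h1c h2c`), IF `I₀ := i_B(χ_ξ) = cmPrincipalSeries L 3 v χ_ξ`
(`= normalizedInd (cmBorelTriple L 3 v) (𝟙 ⊗ χ_ξ)` by two `δ`-steps, ★ `principalSeries`) is reducible (`hred`), then ★ `labelledPair_of_reducible` (fed with ★ N1∕N2∕N3) gives the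
labelled pair `πs ≠ πn` — constituents exactly `{πn, πs}`, `r_B(πs) ≅ ℂ_{χ_ξ}`, `r_B(πn) ≅ ℂ_{wχ_ξ}` (`πs = π²(ξ)`, `πn = πⁿ(ξ)`) — and ★ row 63 (4) `IrrClass.exists_realisation_schurPair`
at `t := cmBorelTriple L 3 v`, `θ₂ := χ_ξ`, `θ₁ := wχ_ξ` (`hδ` ★ `deltaChar_cmBorel_eq_one`, admissibility ★ `isAdmissible_cmPrincipalSeries`, `hlen := ` ★ N3, `K := ` ★
`exists_isOpen_isCompact_subgroup_cmLocal`) REALISES `π²(ξ)` as a `G`-stable `A ≤ i_B(χ_ξ)` with: (`hAirr`) every `G`-stable `B ≤ A` is `0` or `A`; (`hHom0`)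
`Hom_G(i_B(χ_ξ)|_A, i_B(χ_ξ)∕A) = 0`; (`hSchur`) `dim End_G(i_B(χ_ξ)|_A) = 1`; the LABELS `⟦i_B(χ_ξ)|_A⟧ = πs = π²(ξ)`, `⟦i_B(χ_ξ)∕A⟧ = πn = πⁿ(ξ)`; and (d2a′) `r_B(i_B(χ_ξ)∕A) ≠ 0`
— the letters `(A hAinv hAirr hHom0 hSchur)` of ★ 40″ `selfExtension_splits_of_jacquet_selfExtension` at `χ₁ := 𝟙 ⊗ χ_ξ` (the PRINTED orientation: `π²(ξ)` IS the sub of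
`i_B(χ_ξ)`), with the class labels and (d2a′) BY NAME (what the 400000-heartbeat rider ★ `F0P3cStCharTSPiTwoRealisation` leaves to its consumer).

ELABORATION NOTE.  The statement reads `cmXiTorusChar … : ↥(torusU …) →* ℂˣ` on `↥(cmBorelTriple L 3 v).M`, `IrrClass (Gqs L v)` against representations of `↥(unitaryGroupOfForm …)`,
and `Subrepresentation (cmPrincipalSeries …)` against `normalizedInd (cmBorelTriple …) …`: the same definitional bookkeeping of the CM carrier as ★ `F0P3KeysLabelledPair` (10⁸),
★ 64-B∕64-C (2·10⁷); the budget below is that class, measured necessary on the farm (10⁷ fails at the theorem head with an `isDefEq` timeout, 2·10⁷ passes), local to the one theorem.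

* `exists_piTwoRealisation_schurPair` — the one head.
[cite: Rogawski1990, §12.2 (2) pp. 173–174] [cite: Keys1984, §3 pp. 118–119; §7 Thm (2)] [cite: Casselman1995, Thm 3.2.4, Cor. 6.3.9, Cor. 7.1.2] [cite: Bump1997, Proposition 4.2.4]

## References
* [Rogawski1990] J. D. Rogawski, *Automorphic Representations of Unitary Groups in Three Variables*, Ann. of Math. Stud. 123 (1990): §12.2 (2) pp. 173–174.
* [Keys1984] D. Keys, *Principal series representations of special unitary groups over local fields*, Compositio Math. 51 (1984): §3 pp. 118–119, §7.
* [Casselman1995] W. Casselman, *Introduction to the theory of admissible representations of p-adic reductive groups* (1995): Thm 3.2.4, Cor. 6.3.9, Cor. 7.1.2.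
* [Bump1997] D. Bump, *Automorphic Forms and Representations* (1997): Proposition 4.2.4.
-/

set_option autoImplicit false

set_option linter.dupNamespace false

noncomputable section

open NumberField IsDedekindDomain
open scoped MatrixGroups

namespace Summit.HodgeConjecture.HodgeConjecture.Cruxes.H413.F0P3cStCharTSPiTwoRealisationXi

open Literature.NumberTheory.Automorphic Literature.NumberTheory.Automorphic.UnitaryGroup Literature.NumberTheory.Rogawski1990
open Summit.HodgeConjecture.HodgeConjecture.Cruxes.H413

variable (L : Type) [Field L] [NumberField L] [IsCMField L] (v : HeightOneSpectrum (𝓞 ↥(maximalRealSubfield L)))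

set_option synthInstance.maxHeartbeats 400000 in
set_option maxHeartbeats 20000000 in  -- `cmXiTorusChar` on `torusU` read on `(cmBorelTriple L 3 v).M`, `Gqs` vs `unitaryGroupOfForm`, `cmPrincipalSeries` vs `normalizedInd`: the CM-carrier bookkeeping class of ★ `F0P3KeysLabelledPair` ∕ ★ 64-C (see ELABORATION NOTE)
/-- **E1 ROW 63-C — THE K2′ REALISATION AT THE CM DATUM.**  At a place `v` of `L⁺` non-split in `L`, for `χ_ξ = cmXiTorusChar L v μ η₁ η₂` with `i_B(χ_ξ)` REDUCIBLE (`hred`): there are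
the labelled pair `πs ≠ πn` of `i_B(χ_ξ)` (constituents exactly `πn, πs`; `πs = π²(ξ)`, `πn = πⁿ(ξ)`) and a `G`-stable `A ≤ I₀ := normalizedInd (cmBorelTriple L 3 v) (𝟙 ⊗ χ_ξ)`
(`= i_B(χ_ξ)`) with: no `G`-stable submodule strictly between `⊥` and `A` (`hAirr`), `Hom_G(I₀|_A, I₀∕A) = 0` (`hHom0`), `dim End_G(I₀|_A) = 1` (`hSchur`), `⟦I₀|_A⟧ = πs`,
`⟦I₀∕A⟧ = πn`, and `r_B(I₀∕A) ≠ 0` — ONE call of ★ row 63 (4) `IrrClass.exists_realisation_schurPair` at `θ₂ := χ_ξ`, `θ₁ := wχ_ξ` over ★ `labelledPair_of_reducible` (★ N1∕N2∕N3),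
★ `isAdmissible_cmPrincipalSeries`, ★ N3, ★ `deltaChar_cmBorel_eq_one`, ★ `exists_isOpen_isCompact_subgroup_cmLocal`.
[cite: Rogawski1990, §12.2 (2) pp. 173–174] [cite: Keys1984, §7 Thm (2)] [cite: Casselman1995, Thm 3.2.4, Cor. 6.3.9, Cor. 7.1.2] [cite: Bump1997, Proposition 4.2.4] -/
theorem exists_piTwoRealisation_schurPair (hns : ∀ w : PlacesOver L v, IsCMField.complexConj L • w.1 = w.1)
    (μ : (LocalRing L v)ˣ →* ℂˣ) (η₁ η₂ : ↥(normOneUnits (conjLocal L (IsCMField.complexConj L) v)) →* ℂˣ)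
    (hμ : IsQuadraticCharExtension (conjLocal L (IsCMField.complexConj L) v) μ)
    (hμc : Continuous fun x => ((μ x : ℂˣ) : ℂ)) (h1c : Continuous fun x => ((η₁ x : ℂˣ) : ℂ)) (h2c : Continuous fun x => ((η₂ x : ℂˣ) : ℂ))
    (hred : ∃ N : Subrepresentation (cmPrincipalSeries L 3 v (cmXiTorusChar L v μ η₁ η₂)), N ≠ ⊥ ∧ N ≠ ⊤) :
    haveI := locallyCompactSpace_cmBorelU L 3 v
    ∃ πs πn : IrrClass (Gqs L v), πs ≠ πn ∧
      (∀ c : IrrClass (Gqs L v), c.IsConstituentOf (cmPrincipalSeries L 3 v (cmXiTorusChar L v μ η₁ η₂)) ↔ (c = πn ∨ c = πs)) ∧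
      ∃ (A : Submodule ℂ (Representation.SmoothInd (cmBorelTriple L 3 v).P
            (Representation.twist (((Representation.trivial ℂ ↥(cmBorelTriple L 3 v).M ℂ).twist (cmXiTorusChar L v μ η₁ η₂)).comp (cmBorelTriple L 3 v).proj)
              (rootDeltaChar (cmBorelTriple L 3 v).P))))
        (hAinv : ∀ g, A ≤ A.comap ((Representation.normalizedInd (cmBorelTriple L 3 v) ((Representation.trivial ℂ ↥(cmBorelTriple L 3 v).M ℂ).twist (cmXiTorusChar L v μ η₁ η₂))) g)),
        (∀ B : Submodule ℂ _, B ≤ A → (∀ g, B ≤ B.comap ((Representation.normalizedInd (cmBorelTriple L 3 v) ((Representation.trivial ℂ ↥(cmBorelTriple L 3 v).M ℂ).twist (cmXiTorusChar L v μ η₁ η₂))) g)) → B = ⊥ ∨ B = A) ∧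
        (∀ ψ : Representation.IntertwiningMap ((Representation.normalizedInd (cmBorelTriple L 3 v) ((Representation.trivial ℂ ↥(cmBorelTriple L 3 v).M ℂ).twist (cmXiTorusChar L v μ η₁ η₂))).subrepresentation A hAinv) ((Representation.normalizedInd (cmBorelTriple L 3 v) ((Representation.trivial ℂ ↥(cmBorelTriple L 3 v).M ℂ).twist (cmXiTorusChar L v μ η₁ η₂))).quotient A hAinv), ψ = 0) ∧
        Module.finrank ℂ (Representation.IntertwiningMap ((Representation.normalizedInd (cmBorelTriple L 3 v) ((Representation.trivial ℂ ↥(cmBorelTriple L 3 v).M ℂ).twist (cmXiTorusChar L v μ η₁ η₂))).subrepresentation A hAinv) ((Representation.normalizedInd (cmBorelTriple L 3 v) ((Representation.trivial ℂ ↥(cmBorelTriple L 3 v).M ℂ).twist (cmXiTorusChar L v μ η₁ η₂))).subrepresentation A hAinv)) = 1 ∧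
        (∃ (hirr : ((Representation.normalizedInd (cmBorelTriple L 3 v) ((Representation.trivial ℂ ↥(cmBorelTriple L 3 v).M ℂ).twist (cmXiTorusChar L v μ η₁ η₂))).subrepresentation A hAinv).IsIrreducible) (hsm : ((Representation.normalizedInd (cmBorelTriple L 3 v) ((Representation.trivial ℂ ↥(cmBorelTriple L 3 v).M ℂ).twist (cmXiTorusChar L v μ η₁ η₂))).subrepresentation A hAinv).IsSmooth),
          IrrClass.mk (SmoothIrrep.mk ↥A _ hirr hsm) = πs) ∧
        (∃ (hirr : ((Representation.normalizedInd (cmBorelTriple L 3 v) ((Representation.trivial ℂ ↥(cmBorelTriple L 3 v).M ℂ).twist (cmXiTorusChar L v μ η₁ η₂))).quotient A hAinv).IsIrreducible) (hsm : ((Representation.normalizedInd (cmBorelTriple L 3 v) ((Representation.trivial ℂ ↥(cmBorelTriple L 3 v).M ℂ).twist (cmXiTorusChar L v μ η₁ η₂))).quotient A hAinv).IsSmooth),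
          IrrClass.mk (SmoothIrrep.mk (_ ⧸ A) _ hirr hsm) = πn) ∧
        Nontrivial ((cmBorelTriple L 3 v).restrict ((Representation.normalizedInd (cmBorelTriple L 3 v) ((Representation.trivial ℂ ↥(cmBorelTriple L 3 v).M ℂ).twist (cmXiTorusChar L v μ η₁ η₂))).quotient A hAinv)).Coinvariants := by
  haveI := locallyCompactSpace_cmBorelU L 3 v
  obtain ⟨K, hKo, hKc⟩ := F0P3bCentralCharacterUnitaryNonsplit.exists_isOpen_isCompact_subgroup_cmLocal L 3 v
  have hadm := F0P3XiUnramNonsplitInstance.isAdmissible_cmPrincipalSeries L v (cmXiTorusChar L v μ η₁ η₂)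
  have hc1 := continuous_cmXiTorusChar_fst L v μ η₁ hμc h1c
  have hlen := F0P3U3PrincipalSeriesLettersHold.u3PrincipalSeriesLengthLeTwo_holds L v hns _ η₂ hc1 h2c
  have H := F0P3KeysLabelledPair.labelledPair_of_reducible L v
    (F0P3U3PrincipalSeriesJacquetFiltrationHolds.U3PrincipalSeriesJacquetFiltration_holds L)
    (F0P3U3PrincipalSeriesLettersHold.u3PrincipalSeriesConstituentEmbeds_holds L)
    (F0P3U3PrincipalSeriesLettersHold.u3PrincipalSeriesLengthLeTwo_holds L) hns μ η₁ η₂ hμ hμc h1c h2c hred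
  cases H with
  | intro πs H =>
  cases H with
  | intro πn H =>
  cases H with
  | intro hne H =>
  cases H with
  | intro hJH H =>
  cases H with
  | intro hs hn =>
  exact ⟨πs, πn, hne, hJH, IrrClass.exists_realisation_schurPair (cmBorelTriple L 3 v) (F0P2nBorelCharactersUnipotent.deltaChar_cmBorel_eq_one L v)
    hadm hKo hKc hlen hne hJH hs hn⟩

end Summit.HodgeConjecture.HodgeConjecture.Cruxes.H413.F0P3cStCharTSPiTwoRealisationXi

end
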